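import Literature.MathematicalPhysics.QuantumFieldTheory.Balaban1983to89.Node00.TorusCoverLandau153RecTowerDoorGrad
import Literature.MathematicalPhysics.QuantumFieldTheory.Balaban1983to89.Node00.TorusCoverLandau153RecDatumDoorOfCrown

/-!
# NODE 00 — THE R7 DOOR AT THE PRINT DATUM WITH (T2b) (pen (j-iii) of plan g93's WORD A3⁵, third link): STAGE 3, the datum door and the crown-fed door of g10
# (`exists_localGauge152_recTower_member` ∕ `exists_datumGauge152_153_member_of_recBody` ∕ `…_of_crownAt`) VERBATIM over the `_grad` chain, the last one EXPORTING
# [Balaban1985Variational] (152) member 2 «(L^{j′}η)²|∇^η A| ≤ …» AT EVERY LEVEL in the head's torus currency `regionOfSet(π″□_{j′}).dpairs`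

Cell `pub-ymgap`, width seat `pub-ymgap-dag-n07-w3` g12 (plan g93 WORD A3⁵ = ρ3 «φ-form», pen (j-iii) = (T2b)).  NEW leaf; CONSUMED BY NAME, nothing modified: g10's
`Node00.TorusCoverLandau153RecTowerMember` (windows, `image_coverShift_*`, `injOn_coverShift_tcubeZ`, `add_e_mem_*_of_shift_mem_image`), `…RecDatumDoor`,
`…RecDatumDoorOfCrown` (`propCubePZ_sq_eq_cubeZ`, `add_e_mem_cubeZ_of_coverShift_mem_image`, `norm_le_of_mem_regionOfSet_cover_image_cube`, `injOn_cover_tcube_of_guard`,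
`inAk_coverLiftShift_tcubeZ_of_top`, `tol_of_level_pred`), `…RecCubeDomains.RE_dsE_re_im_eq_zero_meet_of_isLandau138Z_propCubePZ`; this seat's `_grad` links 1–2.
`--kind proof --supports stmt-QuantumFields-20541` (K0⁷; count-neutral).  [6] = [Balaban1985RegularSpaces]; [15] = [Balaban1985Variational]; [I] = [Balaban1987RG1].

WHAT THIS FILE PROVES.  §1 ★★ `exists_localGauge152_recTower_member_grad` (STAGE 3 + the two ℤᵈ conjuncts); §2 ★★ `exists_datumGauge152_153_member_of_recBody_grad` (datum door +
the two ℤᵈ conjuncts); §3 ★★ `norm_grad_le_of_mem_regionOfSet_cover_image_cube` — THE one new bookkeeping block: the dpairs twin of g10's bonds lemma; §4 ★★★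
`exists_datumGauge152_153_member_of_crownAt_grad` — the crown-fed door WITH the torus row (T2b) at every level `j′ ≤ k`: `‖grad‖ ≤ 2·(Cr·L³·ε_{k−1})·((L^{j′}η_k)²)⁻¹`
(`= 2·Cr·L³·ε_{k−1}·L^{2(k−j′)}`), SAME `A` as rows 1–8.  The knit into `HThm4RecMember152` (row 5 at every level, `< κ·ε_k·L^{2(k−j′)}`) is the next file.
HONEST FRAMING: count-neutral; bookkeeping (verbatim re-runs + one stencil pull-back); nothing of [6]∕[15]∕[I] asserted; `HThm4Rec*` premises CONDITIONAL; N05 ∕ N07 NOT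
discharged; COUNT 8∕27 · K 1∕4 UNMOVED; one finite 𝕋⁴ programme at fixed ε — R4 closes the conditional finite-𝕋⁴ rung `BalabanLadder.UV` only; the YM mass gap (Clay) is NOT
proved by any of this; nothing continuum ∕ ℝ⁴ ∕ OS.  No `def`, no `instance`, no `notation`, no `sorry`.
-/

noncomputable section

namespace Literature.MathematicalPhysics.QuantumFieldTheory.Balaban1983to89.Node00

open scoped Matrix.Norms.L2Operator
open B7Prop1Explicit (e e_apply gaugeAct)
open B7Prop1Local (InBox AgreeOn)
open B7Prop2Explicit (unitaryUnits mem_unitaryUnits)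
open B7Prop2SpecialUnitary (specialUnitaryUnits mem_specialUnitaryUnits)
open BlockAveragingZd (avgIterZ ctrShift)
open B8Ineq132 (covDerivFwd covDeriv BondTouches InAk)
open B8Eq131Cubes (box cube tcube tLo tHi ctr gs)
open B8Eq131CubesRec (boxZ cubeZ tcubeZ bLoZ bHiZ)
open B8Eq131CubesRecDictionary (mem_cubeZ_iff_add_ctrShift)
open B8Eq140Level (SideTouches)
open B8Eq138LandauZd (logCfg covDivB covLap)
open B8Eq138LandauZdRec (IsLandau138Z IsLandau138WZ)
open B8Eq119TwistedAxialRec (Restr129Z)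
open B7SectEFLinearisationRec (logCovIterZ)
open B8Eq184Proof (cfgExp)
open B8LeafModelZd3 (mlogCfg)
open B8ScaledSupNorm (msup Bdd bondNorm)
open B8Eq146AExpansion (plaqCovDeriv iEta)
open B8Eq143PlaqExpansion (pdiv)
open MatrixLog (mlog)
open B15Eq112TorusCover (cover)
open B14DomainGeom (Pt)
open B12RegularSpaces111 (gaugeU expI grad)
open B6SectADomainsV1 (Domains)
open B6SectAOperatorsV1 (RE dsE QpE)
open BalabanImbrieJaffe1984to88.BIJ85AxialPropagator411 (BondSpace)

variable {P : Params} {N : ℕ} [NeZero N]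

/-! ## §1  STAGE 3 with the pass-through -/

/-- ★★ **STAGE 3 OF THE R7 DOOR (the canonical windows `□₀ᶻ ∕ □ᶻ ∕ □̃ᶻ`) WITH THE ALL-LEVELS GRADIENT LETTER AND THE `(−2)` ROW PASSED THROUGH** — g10's
`exists_localGauge152_recTower_member` VERBATIM plus the two ℤᵈ-side conjuncts on the exported `u_m`.
[cite: Balaban1985Variational, (144)–(153) pp.300–301; Balaban1985RegularSpaces, Prop. 6 (1.135)–(1.138) p.99, (1.29) p.81, (1.131) p.99, p.98; Balaban1985Averaging, (78)–(81) p.30; Balaban1987RG1, (0.1) p.251, (0.3)–(0.4) pp.252–253] -/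
theorem exists_localGauge152_recTower_member_grad (hd : 2 ≤ P.d) {K' : ℕ} {Ω' : ℕ → Set (B7Prop1Explicit.Site P.d)} (c : CubeB8DZ P.d P.L K' Ω')
    (U : GaugeField P 0 (SU N)) {n : ℕ} (hk : c.k = n) {r : ℝ} (hr : 0 ≤ r)
    (hG : letI : CStarAlgebra (MatA N) := {};
      ∃ u : B7Prop1Explicit.Site P.d → (MatA N)ˣ, (∀ x, u x ∈ specialUnitaryUnits (Fin N)) ∧ (∀ x, x ∉ c.sq 0 → u x = 1) ∧
        Restr129Z P.L c.k c.lamS (1 : B7Prop1Explicit.Site P.d → Fin P.d → (MatA N)ˣ) u ∧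
        IsLandau138WZ P.L c.k (P.eta n) (c.sq 0) c.lamS (1 : B7Prop1Explicit.Site P.d → Fin P.d → (MatA N)ˣ)
          (c.fixed (fun x μ => ιSU N (U ⟨cover P (x + fun _ => (ctrShift P.L c.k : ℤ)), μ⟩)) u) ∧
        (∀ j, j ≤ c.k → ∀ b ∈ {b : B7Prop1Explicit.Site P.d × Fin P.d | SideTouches (c.sq j) b.1 b.2},
          c.fixed (fun x μ => ιSU N (U ⟨cover P (x + fun _ => (ctrShift P.L c.k : ℤ)), μ⟩)) u b.1 b.2 =
              cfgExp (P.eta n) (logCfg (P.eta n) (c.fixed (fun x μ => ιSU N (U ⟨cover P (x + fun _ => (ctrShift P.L c.k : ℤ)), μ⟩)) u)) b.1 b.2 ∧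
            IsSelfAdjoint (logCfg (P.eta n) (c.fixed (fun x μ => ιSU N (U ⟨cover P (x + fun _ => (ctrShift P.L c.k : ℤ)), μ⟩)) u) b.1 b.2) ∧
            ‖logCfg (P.eta n) (c.fixed (fun x μ => ιSU N (U ⟨cover P (x + fun _ => (ctrShift P.L c.k : ℤ)), μ⟩)) u) b.1 b.2‖ ≤ r * ((P.L : ℝ) ^ j * P.eta n)⁻¹) ∧
        (∀ x, ((c.vfix (fun x μ => ιSU N (U ⟨cover P (x + fun _ => (ctrShift P.L c.k : ℤ)), μ⟩)))⁻¹ * u) x ∈ specialUnitaryUnits (Fin N)) ∧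
        AgreeOn (B8Ineq130Rec.tlo P.L (tLo c.a c.ρ) c.k) (B8Ineq130Rec.thi P.L (tHi c.a c.M c.ρ) c.k)
          (gaugeAct ((c.vfix (fun x μ => ιSU N (U ⟨cover P (x + fun _ => (ctrShift P.L c.k : ℤ)), μ⟩)))⁻¹ * u)⁻¹
            (fun x μ => ιSU N (U ⟨cover P (x + fun _ => (ctrShift P.L c.k : ℤ)), μ⟩)))
          (c.fixed (fun x μ => ιSU N (U ⟨cover P (x + fun _ => (ctrShift P.L c.k : ℤ)), μ⟩)) u) ∧
        msup P.L c.k (P.eta n) (-(2 : ℝ)) (fun j (q : Fin P.d × Fin P.d × B7Prop1Explicit.Site P.d) => SideTouches (c.sq j) q.2.2 q.2.1)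
            (fun q => covDerivFwd (P.eta n) (1 : B7Prop1Explicit.Site P.d → Fin P.d → (MatA N)ˣ) q.1
              (fun z => c.expo (P.eta n) (fun x μ => ιSU N (U ⟨cover P (x + fun _ => (ctrShift P.L c.k : ℤ)), μ⟩)) u z q.2.1) q.2.2) ≤ r ∧
        bondNorm P.L c.k (P.eta n) (-(3 : ℝ)) c.sq
            (fun x μ => pdiv (P.eta n) (1 : B7Prop1Explicit.Site P.d → Fin P.d → (MatA N)ˣ)
              (plaqCovDeriv (P.eta n) (1 : B7Prop1Explicit.Site P.d → Fin P.d → (MatA N)ˣ)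
                (c.expo (P.eta n) (fun x μ => ιSU N (U ⟨cover P (x + fun _ => (ctrShift P.L c.k : ℤ)), μ⟩)) u)) μ x) ≤ r ∧
        bondNorm P.L c.k (P.eta n) (-(3 : ℝ)) c.sq
            (fun x μ => covLap (P.eta n) (1 : B7Prop1Explicit.Site P.d → Fin P.d → (MatA N)ˣ)
              (fun z => c.expo (P.eta n) (fun x μ => ιSU N (U ⟨cover P (x + fun _ => (ctrShift P.L c.k : ℤ)), μ⟩)) u z μ) x) ≤ r ∧
        (∀ (x : B7Prop1Explicit.Site P.d) (μ : Fin P.d), bLoZ P.L c.a 0 0 ≤ x → x + e μ ≤ bHiZ P.L c.a c.M 0 0 → c.inTop x → c.inTop (x + e μ) →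
          logCovIterZ P.L (1 : B7Prop1Explicit.Site P.d → Fin P.d → (MatA N)ˣ)
              (iEta (P.eta n) (c.expo (P.eta n) (fun x μ => ιSU N (U ⟨cover P (x + fun _ => (ctrShift P.L c.k : ℤ)), μ⟩)) u)) c.k x μ =
            mlog ((avgIterZ P.L (c.axial (fun x μ => ιSU N (U ⟨cover P (x + fun _ => (ctrShift P.L c.k : ℤ)), μ⟩))) c.k x μ : (MatA N)ˣ) : MatA N)))
    (hinj : Set.InjOn (cover P) (tcube P.L c.a c.M c.ρ c.k)) (h4 : 4 * ((N : ℝ) * r) < 2 * Real.pi) :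
    letI : CStarAlgebra (MatA N) := {}
    ∃ u : GaugeTransf P 0 (SU N), ∃ A : PBond P 0 → MatA N, ∃ um : B7Prop1Explicit.Site P.d → (MatA N)ˣ,
      (∀ b ∈ (Sect2.regionOfSet P (cover P '' cube P.L c.a c.M c.ρ c.k 0)).bonds, gaugeU (fun x => ιSU N (u x)) (fun b' => ιSU N (U b')) b = expI (P.eta n) (A b)) ∧
      (∀ j, j ≤ c.k → ∀ (x : Pt P.d) (μ : Fin P.d), x ∈ c.sq j → x + e μ ∈ c.sq j →
          ‖A ⟨cover P (x + fun _ => (ctrShift P.L c.k : ℤ)), μ⟩‖ ≤ 2 * (r * ((P.L : ℝ) ^ j * P.eta n)⁻¹)) ∧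
      (∀ b ∈ (Sect2.regionOfSet P (cover P '' box P.L c.a c.M c.k)).bonds, ‖A b‖ ≤ 2 * (r * P.L)) ∧
      (∀ q ∈ (Sect2.regionOfSet P (cover P '' box P.L c.a c.M c.k)).dpairs, ‖grad (P.eta n) q.2.1 (fun y => A ⟨y, q.2.2⟩) q.1‖ ≤ 2 * (r * (P.L : ℝ) ^ 2)) ∧
      (∀ b ∈ Sect2.bondsDeep (cover P '' box P.L c.a c.M c.k), ‖Sect2.codiffCurlA (P.eta n) A b.src b.dir‖ ≤ 2 * (r * (P.L : ℝ) ^ 3)) ∧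
      (∀ b ∈ Sect2.bondsDeep (cover P '' box P.L c.a c.M c.k),
          ‖∑ ν : Fin P.d, ((P.eta n : ℝ) : ℂ)⁻¹ •
              (grad (P.eta n) ν (fun y => A ⟨y, b.dir⟩) (b.src.unshift ν) - grad (P.eta n) ν (fun y => A ⟨y, b.dir⟩) b.src)‖ ≤ 2 * (r * (P.L : ℝ) ^ 3)) ∧
      (∀ x, x ∈ tcubeZ P.L c.a c.M c.ρ c.k → ∀ μ,
          A ⟨cover P (x + fun _ => (ctrShift P.L c.k : ℤ)), μ⟩ = logCfg (P.eta n) (c.fixed (fun x μ => ιSU N (U ⟨cover P (x + fun _ => (ctrShift P.L c.k : ℤ)), μ⟩)) um) x μ) ∧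
      IsLandau138Z P.L c.k (P.eta n) (c.sq 0) c.lamS (1 : B7Prop1Explicit.Site P.d → Fin P.d → (MatA N)ˣ)
        (logCfg (P.eta n) (c.fixed (fun x μ => ιSU N (U ⟨cover P (x + fun _ => (ctrShift P.L c.k : ℤ)), μ⟩)) um)) ∧
      (∀ x, x ∈ c.sq 0 →
          ιSU N (u (cover P (x + fun _ => (ctrShift P.L c.k : ℤ)))) = (um x)⁻¹ * c.vfix (fun x μ => ιSU N (U ⟨cover P (x + fun _ => (ctrShift P.L c.k : ℤ)), μ⟩)) x) ∧
      (∀ x, um x ∈ specialUnitaryUnits (Fin N)) ∧ (∀ x, x ∉ c.sq 0 → um x = 1) ∧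
      Restr129Z P.L c.k c.lamS (1 : B7Prop1Explicit.Site P.d → Fin P.d → (MatA N)ˣ) um ∧
      (∀ (x : B7Prop1Explicit.Site P.d) (μ : Fin P.d), bLoZ P.L c.a 0 0 ≤ x → x + e μ ≤ bHiZ P.L c.a c.M 0 0 → c.inTop x → c.inTop (x + e μ) →
        logCovIterZ P.L (1 : B7Prop1Explicit.Site P.d → Fin P.d → (MatA N)ˣ)
            (iEta (P.eta n) (c.expo (P.eta n) (fun x μ => ιSU N (U ⟨cover P (x + fun _ => (ctrShift P.L c.k : ℤ)), μ⟩)) um)) c.k x μ =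
          mlog ((avgIterZ P.L (c.axial (fun x μ => ιSU N (U ⟨cover P (x + fun _ => (ctrShift P.L c.k : ℤ)), μ⟩))) c.k x μ : (MatA N)ˣ) : MatA N)) ∧
      -- ★ NEW (T2b input, ℤᵈ side, passed through): (152) member 2 at EVERY level for the exported `um`
      (∀ j, j ≤ c.k → ∀ (x : B7Prop1Explicit.Site P.d) (μ ν : Fin P.d), x ∈ c.sq j → x + e μ ∈ c.sq j →
          ‖logCfg (P.eta n) (c.fixed (fun x μ => ιSU N (U ⟨cover P (x + fun _ => (ctrShift P.L c.k : ℤ)), μ⟩)) um) (x + e μ) ν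
              - logCfg (P.eta n) (c.fixed (fun x μ => ιSU N (U ⟨cover P (x + fun _ => (ctrShift P.L c.k : ℤ)), μ⟩)) um) x ν‖ ≤
            2 * (P.eta n * r * (((P.L : ℝ) ^ j * P.eta n) ^ 2)⁻¹)) ∧
      -- ★ NEW (pass-through): the crown's `(−2)` row for `um`
      msup P.L c.k (P.eta n) (-(2 : ℝ)) (fun j (q : Fin P.d × Fin P.d × B7Prop1Explicit.Site P.d) => SideTouches (c.sq j) q.2.2 q.2.1)
          (fun q => covDerivFwd (P.eta n) (1 : B7Prop1Explicit.Site P.d → Fin P.d → (MatA N)ˣ) q.1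
            (fun z => c.expo (P.eta n) (fun x μ => ιSU N (U ⟨cover P (x + fun _ => (ctrShift P.L c.k : ℤ)), μ⟩)) um z q.2.1) q.2.2) ≤ r := by
  letI : CStarAlgebra (MatA N) := {}
  have hLo : Odd P.L := P.hL.1
  have hL : 2 ≤ P.L := P.hL.2
  have hρ1 : 1 ≤ c.ρ := le_trans (le_trans (by norm_num) hL) c.L_le_ρ
  -- the canonical windows `X := Ω′₀ = □₀ᶻ`, `X_t := □ᶻ`, `X′ := □̃ᶻ`
  have hXX' : c.sq 0 ⊆ tcubeZ P.L c.a c.M c.ρ c.k := CubeB8DZ.sq_zero_subset_tcube hLo hL c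
  have hXt : boxZ P.L c.a c.M c.k ⊆ c.sq 0 := by
    rw [c.sq_zero]; exact B8Eq131CubesRec.box_subset_cube hLo (Nat.zero_le _)
  have hbox : boxZ P.L c.a c.M c.k ⊆ cubeZ P.L c.a c.M c.ρ c.k c.k := B8Eq131CubesRec.box_subset_cube_top hLo c.a c.M c.ρ c.k
  have hinj' := injOn_coverShift_tcubeZ (P := P) (k := c.k) hinj
  have hinj0 : Set.InjOn (cover P) (cube P.L c.a c.M c.ρ c.k 0) := hinj.mono (B8Eq131Cubes.cube_subset_tcube hL hρ1 (Nat.zero_le _))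
  obtain ⟨u, A, um, h1, hlev, h2, h3, h4c, h4', hA7, h5, hsid, hsu, hoff, h129, h137, hgradAll, hmsup⟩ :=
    exists_localGauge152_recTower_window_member_grad hd c U (fun _ => (ctrShift P.L c.k : ℤ)) hk hr hG hXX' hXt hXX' hinj'
      (fun x hx μ h => c.add_e_mem_sq_zero_of_shift_mem_image hinj hx h)
      (fun x hx μ h => c.add_e_mem_boxZ_of_shift_mem_image hinj0 hx h)
      (fun x hx ν h => c.sub_e_mem_boxZ_of_unshift_mem_image hinj0 hx h) subset_rfl hbox h4
  have himg0 : (fun x => cover P (x + fun _ => (ctrShift P.L c.k : ℤ))) '' c.sq 0 = cover P '' cube P.L c.a c.M c.ρ c.k 0 := by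
    rw [c.sq_zero]; exact image_coverShift_cubeZ c.a c.M c.ρ (Nat.zero_le _)
  have himgt : (fun x => cover P (x + fun _ => (ctrShift P.L c.k : ℤ))) '' boxZ P.L c.a c.M c.k = cover P '' box P.L c.a c.M c.k :=
    image_coverShift_boxZ c.a c.M c.k
  rw [himg0] at h1
  rw [himgt] at h2 h3 h4c h4'
  exact ⟨u, A, um, h1, fun j hj x μ hxj hxj' => hlev j hj x μ (c.sq_subset_sq_zero hj hxj) (c.sq_subset_sq_zero hj hxj') hxj hxj',
    h2, h3, h4c, h4', hA7, h5, hsid, hsu, hoff, h129, h137, hgradAll, hmsup⟩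

/-! ## §2  The datum door with the pass-through -/

/-- ★★ **THE R7 DOOR AT THE PRINT DATUM WITH THE ALL-LEVELS GRADIENT LETTER AND THE `(−2)` ROW PASSED THROUGH** — g10's `exists_datumGauge152_153_member_of_recBody` VERBATIM plus the
two ℤᵈ-side conjuncts on the exported `u_m`.
[cite: Balaban1985Variational, (144)–(153) pp.300–301; Balaban1985RegularSpaces, Prop. 6 (1.135)–(1.138) p.99, (1.29) p.81, (1.131) p.99; Balaban1984PropagatorsII, (2.10)–(2.12) p.225; Balaban1985Averaging, (78)–(81) p.30; Balaban1987RG1, (0.1) p.251, (0.3)–(0.4) pp.252–253] -/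
theorem exists_datumGauge152_153_member_of_recBody_grad (hd : 2 ≤ P.d) {k : ℕ} (hk₁ : 1 ≤ k) (hck : k ≤ P.m + P.K) {Mc ρ : ℕ} (hρ : P.L ≤ ρ) (idx : Pt P.d)
    (U : GaugeField P 0 (SU N)) {r : ℝ} (hr : 0 ≤ r)
    (hG : letI : CStarAlgebra (MatA N) := {};
      ∃ u : B7Prop1Explicit.Site P.d → (MatA N)ˣ, (∀ x, u x ∈ specialUnitaryUnits (Fin N)) ∧ (∀ x, x ∉ (propCubePZ P k hk₁ Mc ρ hρ idx).sq 0 → u x = 1) ∧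
        Restr129Z P.L k (propCubePZ P k hk₁ Mc ρ hρ idx).lamS (1 : B7Prop1Explicit.Site P.d → Fin P.d → (MatA N)ˣ) u ∧
        IsLandau138WZ P.L k (P.eta k) ((propCubePZ P k hk₁ Mc ρ hρ idx).sq 0) (propCubePZ P k hk₁ Mc ρ hρ idx).lamS (1 : B7Prop1Explicit.Site P.d → Fin P.d → (MatA N)ˣ)
          ((propCubePZ P k hk₁ Mc ρ hρ idx).fixed (fun x μ => ιSU N (U ⟨cover P (x + fun _ => (ctrShift P.L k : ℤ)), μ⟩)) u) ∧
        (∀ j, j ≤ k → ∀ b ∈ {b : B7Prop1Explicit.Site P.d × Fin P.d | SideTouches ((propCubePZ P k hk₁ Mc ρ hρ idx).sq j) b.1 b.2},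
          (propCubePZ P k hk₁ Mc ρ hρ idx).fixed (fun x μ => ιSU N (U ⟨cover P (x + fun _ => (ctrShift P.L k : ℤ)), μ⟩)) u b.1 b.2 =
              cfgExp (P.eta k) (logCfg (P.eta k) ((propCubePZ P k hk₁ Mc ρ hρ idx).fixed (fun x μ => ιSU N (U ⟨cover P (x + fun _ => (ctrShift P.L k : ℤ)), μ⟩)) u)) b.1 b.2 ∧
            IsSelfAdjoint (logCfg (P.eta k) ((propCubePZ P k hk₁ Mc ρ hρ idx).fixed (fun x μ => ιSU N (U ⟨cover P (x + fun _ => (ctrShift P.L k : ℤ)), μ⟩)) u) b.1 b.2) ∧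
            ‖logCfg (P.eta k) ((propCubePZ P k hk₁ Mc ρ hρ idx).fixed (fun x μ => ιSU N (U ⟨cover P (x + fun _ => (ctrShift P.L k : ℤ)), μ⟩)) u) b.1 b.2‖ ≤
              r * ((P.L : ℝ) ^ j * P.eta k)⁻¹) ∧
        (∀ x, (((propCubePZ P k hk₁ Mc ρ hρ idx).vfix (fun x μ => ιSU N (U ⟨cover P (x + fun _ => (ctrShift P.L k : ℤ)), μ⟩)))⁻¹ * u) x ∈ specialUnitaryUnits (Fin N)) ∧
        AgreeOn (B8Ineq130Rec.tlo P.L (tLo (cornerP P Mc ρ idx) ρ) k) (B8Ineq130Rec.thi P.L (tHi (cornerP P Mc ρ idx) (sideP P Mc ρ) ρ) k)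
          (gaugeAct (((propCubePZ P k hk₁ Mc ρ hρ idx).vfix (fun x μ => ιSU N (U ⟨cover P (x + fun _ => (ctrShift P.L k : ℤ)), μ⟩)))⁻¹ * u)⁻¹
            (fun x μ => ιSU N (U ⟨cover P (x + fun _ => (ctrShift P.L k : ℤ)), μ⟩)))
          ((propCubePZ P k hk₁ Mc ρ hρ idx).fixed (fun x μ => ιSU N (U ⟨cover P (x + fun _ => (ctrShift P.L k : ℤ)), μ⟩)) u) ∧
        msup P.L k (P.eta k) (-(2 : ℝ)) (fun j (q : Fin P.d × Fin P.d × B7Prop1Explicit.Site P.d) => SideTouches ((propCubePZ P k hk₁ Mc ρ hρ idx).sq j) q.2.2 q.2.1)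
            (fun q => covDerivFwd (P.eta k) (1 : B7Prop1Explicit.Site P.d → Fin P.d → (MatA N)ˣ) q.1
              (fun z => (propCubePZ P k hk₁ Mc ρ hρ idx).expo (P.eta k) (fun x μ => ιSU N (U ⟨cover P (x + fun _ => (ctrShift P.L k : ℤ)), μ⟩)) u z q.2.1) q.2.2) ≤ r ∧
        bondNorm P.L k (P.eta k) (-(3 : ℝ)) (propCubePZ P k hk₁ Mc ρ hρ idx).sq
            (fun x μ => pdiv (P.eta k) (1 : B7Prop1Explicit.Site P.d → Fin P.d → (MatA N)ˣ)
              (plaqCovDeriv (P.eta k) (1 : B7Prop1Explicit.Site P.d → Fin P.d → (MatA N)ˣ)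
                ((propCubePZ P k hk₁ Mc ρ hρ idx).expo (P.eta k) (fun x μ => ιSU N (U ⟨cover P (x + fun _ => (ctrShift P.L k : ℤ)), μ⟩)) u)) μ x) ≤ r ∧
        bondNorm P.L k (P.eta k) (-(3 : ℝ)) (propCubePZ P k hk₁ Mc ρ hρ idx).sq
            (fun x μ => covLap (P.eta k) (1 : B7Prop1Explicit.Site P.d → Fin P.d → (MatA N)ˣ)
              (fun z => (propCubePZ P k hk₁ Mc ρ hρ idx).expo (P.eta k) (fun x μ => ιSU N (U ⟨cover P (x + fun _ => (ctrShift P.L k : ℤ)), μ⟩)) u z μ) x) ≤ r ∧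
        (∀ (x : B7Prop1Explicit.Site P.d) (μ : Fin P.d), bLoZ P.L (cornerP P Mc ρ idx) 0 0 ≤ x → x + e μ ≤ bHiZ P.L (cornerP P Mc ρ idx) (sideP P Mc ρ) 0 0 →
          (propCubePZ P k hk₁ Mc ρ hρ idx).inTop x → (propCubePZ P k hk₁ Mc ρ hρ idx).inTop (x + e μ) →
          logCovIterZ P.L (1 : B7Prop1Explicit.Site P.d → Fin P.d → (MatA N)ˣ)
              (iEta (P.eta k) ((propCubePZ P k hk₁ Mc ρ hρ idx).expo (P.eta k) (fun x μ => ιSU N (U ⟨cover P (x + fun _ => (ctrShift P.L k : ℤ)), μ⟩)) u)) k x μ =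
            mlog ((avgIterZ P.L ((propCubePZ P k hk₁ Mc ρ hρ idx).axial (fun x μ => ιSU N (U ⟨cover P (x + fun _ => (ctrShift P.L k : ℤ)), μ⟩))) k x μ : (MatA N)ˣ) :
              MatA N)))
    (hinj : Set.InjOn (cover P) (tcube P.L (cornerP P Mc ρ idx) (sideP P Mc ρ) ρ k)) (h4 : 4 * ((N : ℝ) * r) < 2 * Real.pi) :
    letI : CStarAlgebra (MatA N) := {}
    ∃ u : GaugeTransf P 0 (SU N), ∃ A : PBond P 0 → MatA N, ∃ um : B7Prop1Explicit.Site P.d → (MatA N)ˣ,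
      (∀ b ∈ (Sect2.regionOfSet P (cover P '' cube P.L (cornerP P Mc ρ idx) (sideP P Mc ρ) ρ k 0)).bonds,
          gaugeU (fun x => ιSU N (u x)) (fun b' => ιSU N (U b')) b = expI (P.eta k) (A b)) ∧
      (∀ j, j ≤ k → ∀ (x : Pt P.d) (μ : Fin P.d), x ∈ (propCubePZ P k hk₁ Mc ρ hρ idx).sq j → x + e μ ∈ (propCubePZ P k hk₁ Mc ρ hρ idx).sq j →
          ‖A ⟨cover P (x + fun _ => (ctrShift P.L k : ℤ)), μ⟩‖ ≤ 2 * (r * ((P.L : ℝ) ^ j * P.eta k)⁻¹)) ∧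
      (∀ b ∈ (Sect2.regionOfSet P (cover P '' box P.L (cornerP P Mc ρ idx) (sideP P Mc ρ) k)).bonds, ‖A b‖ ≤ 2 * (r * P.L)) ∧
      (∀ q ∈ (Sect2.regionOfSet P (cover P '' box P.L (cornerP P Mc ρ idx) (sideP P Mc ρ) k)).dpairs,
          ‖grad (P.eta k) q.2.1 (fun y => A ⟨y, q.2.2⟩) q.1‖ ≤ 2 * (r * (P.L : ℝ) ^ 2)) ∧
      (∀ b ∈ Sect2.bondsDeep (cover P '' box P.L (cornerP P Mc ρ idx) (sideP P Mc ρ) k), ‖Sect2.codiffCurlA (P.eta k) A b.src b.dir‖ ≤ 2 * (r * (P.L : ℝ) ^ 3)) ∧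
      (∀ b ∈ Sect2.bondsDeep (cover P '' box P.L (cornerP P Mc ρ idx) (sideP P Mc ρ) k),
          ‖∑ ν : Fin P.d, ((P.eta k : ℝ) : ℂ)⁻¹ •
              (grad (P.eta k) ν (fun y => A ⟨y, b.dir⟩) (b.src.unshift ν) - grad (P.eta k) ν (fun y => A ⟨y, b.dir⟩) b.src)‖ ≤ 2 * (r * (P.L : ℝ) ^ 3)) ∧
      (∀ (D₂ : Domains P) (φ : MatA N →L[ℂ] ℂ),
        RE (domainsMeet (cubeDomains P (cornerP P Mc ρ idx) (sideP P Mc ρ) ρ k hck) D₂) (P.eta k)⁻¹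
            (dsE (P.eta k)⁻¹ (WithLp.toLp 2 fun b => (φ (A b)).re : BondSpace P)) = 0 ∧
          RE (domainsMeet (cubeDomains P (cornerP P Mc ρ idx) (sideP P Mc ρ) ρ k hck) D₂) (P.eta k)⁻¹
            (dsE (P.eta k)⁻¹ (WithLp.toLp 2 fun b => (φ (A b)).im : BondSpace P)) = 0) ∧
      (∀ x, x ∈ tcubeZ P.L (cornerP P Mc ρ idx) (sideP P Mc ρ) ρ k → ∀ μ,
          A ⟨cover P (x + fun _ => (ctrShift P.L k : ℤ)), μ⟩ =
            logCfg (P.eta k) ((propCubePZ P k hk₁ Mc ρ hρ idx).fixed (fun x μ => ιSU N (U ⟨cover P (x + fun _ => (ctrShift P.L k : ℤ)), μ⟩)) um) x μ) ∧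
      (∀ x, x ∈ (propCubePZ P k hk₁ Mc ρ hρ idx).sq 0 →
          ιSU N (u (cover P (x + fun _ => (ctrShift P.L k : ℤ)))) =
            (um x)⁻¹ * (propCubePZ P k hk₁ Mc ρ hρ idx).vfix (fun x μ => ιSU N (U ⟨cover P (x + fun _ => (ctrShift P.L k : ℤ)), μ⟩)) x) ∧
      (∀ x, um x ∈ specialUnitaryUnits (Fin N)) ∧ (∀ x, x ∉ (propCubePZ P k hk₁ Mc ρ hρ idx).sq 0 → um x = 1) ∧
      Restr129Z P.L k (propCubePZ P k hk₁ Mc ρ hρ idx).lamS (1 : B7Prop1Explicit.Site P.d → Fin P.d → (MatA N)ˣ) um ∧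
      (∀ (x : B7Prop1Explicit.Site P.d) (μ : Fin P.d), bLoZ P.L (cornerP P Mc ρ idx) 0 0 ≤ x → x + e μ ≤ bHiZ P.L (cornerP P Mc ρ idx) (sideP P Mc ρ) 0 0 →
        (propCubePZ P k hk₁ Mc ρ hρ idx).inTop x → (propCubePZ P k hk₁ Mc ρ hρ idx).inTop (x + e μ) →
        logCovIterZ P.L (1 : B7Prop1Explicit.Site P.d → Fin P.d → (MatA N)ˣ)
            (iEta (P.eta k) ((propCubePZ P k hk₁ Mc ρ hρ idx).expo (P.eta k) (fun x μ => ιSU N (U ⟨cover P (x + fun _ => (ctrShift P.L k : ℤ)), μ⟩)) um)) k x μ =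
          mlog ((avgIterZ P.L ((propCubePZ P k hk₁ Mc ρ hρ idx).axial (fun x μ => ιSU N (U ⟨cover P (x + fun _ => (ctrShift P.L k : ℤ)), μ⟩))) k x μ : (MatA N)ˣ) :
            MatA N)) ∧
      -- ★ NEW (T2b input, ℤᵈ side): (152) member 2 at EVERY level for the exported `um`
      (∀ j, j ≤ k → ∀ (x : B7Prop1Explicit.Site P.d) (μ ν : Fin P.d), x ∈ (propCubePZ P k hk₁ Mc ρ hρ idx).sq j → x + e μ ∈ (propCubePZ P k hk₁ Mc ρ hρ idx).sq j →
          ‖logCfg (P.eta k) ((propCubePZ P k hk₁ Mc ρ hρ idx).fixed (fun x μ => ιSU N (U ⟨cover P (x + fun _ => (ctrShift P.L k : ℤ)), μ⟩)) um) (x + e μ) ν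
              - logCfg (P.eta k) ((propCubePZ P k hk₁ Mc ρ hρ idx).fixed (fun x μ => ιSU N (U ⟨cover P (x + fun _ => (ctrShift P.L k : ℤ)), μ⟩)) um) x ν‖ ≤
            2 * (P.eta k * r * (((P.L : ℝ) ^ j * P.eta k) ^ 2)⁻¹)) ∧
      -- ★ NEW (pass-through): the crown's `(−2)` row for `um`
      msup P.L k (P.eta k) (-(2 : ℝ)) (fun j (q : Fin P.d × Fin P.d × B7Prop1Explicit.Site P.d) => SideTouches ((propCubePZ P k hk₁ Mc ρ hρ idx).sq j) q.2.2 q.2.1)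
          (fun q => covDerivFwd (P.eta k) (1 : B7Prop1Explicit.Site P.d → Fin P.d → (MatA N)ˣ) q.1
            (fun z => (propCubePZ P k hk₁ Mc ρ hρ idx).expo (P.eta k) (fun x μ => ιSU N (U ⟨cover P (x + fun _ => (ctrShift P.L k : ℤ)), μ⟩)) um z q.2.1) q.2.2) ≤ r := by
  letI : CStarAlgebra (MatA N) := {}
  set c := propCubePZ P k hk₁ Mc ρ hρ idx with hc
  obtain ⟨u, A, um, h1, hlev, h2, h3, h4c, h4', hA7, h5, hsid, hsu, hoff, h129, h137, hgradAll, hmsup⟩ :=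
    exists_localGauge152_recTower_member_grad (P := P) (N := N) hd c U (n := k) rfl hr hG hinj h4
  have hinj0 : Set.InjOn (cover P) (cube P.L (cornerP P Mc ρ idx) (sideP P Mc ρ) ρ k 0) :=
    hinj.mono (B8Eq131Cubes.cube_subset_tcube P.hL.2 (le_trans (le_trans (by norm_num) P.hL.2) hρ) (Nat.zero_le _))
  have hA0 : ∀ x, x ∈ c.sq 0 → ∀ κ, A ⟨cover P (x + fun _ => (ctrShift P.L k : ℤ)), κ⟩ =
      logCfg (P.eta k) (c.fixed (fun x μ => ιSU N (U ⟨cover P (x + fun _ => (ctrShift P.L k : ℤ)), μ⟩)) um) x κ :=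
    fun x hx κ => hA7 x (CubeB8DZ.sq_zero_subset_tcube P.hL.1 P.hL.2 c hx) κ
  exact ⟨u, A, um, h1, hlev, h2, h3, h4c, h4', fun D₂ φ => RE_dsE_re_im_eq_zero_meet_of_isLandau138Z_propCubePZ hk₁ hρ idx hck hinj0 hA0 h5 D₂ φ,
    hA7, hsid, hsu, hoff, h129, h137, hgradAll, hmsup⟩

/-! ## §3  The derivative-stencil pull-back (the one new bookkeeping block) -/

omit [NeZero N] in
/-- ★★ **GRADIENT LETTERS IN THE TORUS CURRENCY OF THE HEAD's GRADIENT ROW, AT EVERY LEVEL** (the dpairs twin of g10's `norm_le_of_mem_regionOfSet_cover_image_cube`): if the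
torus potential `A` is identified with a `ℤᵈ` field `A′` on `□₀ᶻ` through the translated cover, and `‖A′(x + e_μ, ν) − A′(x, ν)‖ ≤ η·R_j` for `x, x + e_μ ∈ □_jᶻ`, then
`‖grad η μ (A ⟨·, ν⟩) y‖ ≤ R_j` for every derivative stencil `(y, μ, ν)` of `regionOfSet (π '' □_j)` — each such stencil's base is the image of exactly one site of `□_jᶻ` and its
forward `μ`-step stays in `□_jᶻ` (non-wrapping of `□̃`, `add_e_mem_cubeZ_of_coverShift_mem_image`).
[cite: Balaban1985Variational, (152) p.301 («(L^jη)²|∇^η A|»); Balaban1985RegularSpaces, (1.136) p.99, p.98; Balaban1987RG1, (0.1) p.251, (1.14) p.262] -/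
theorem norm_grad_le_of_mem_regionOfSet_cover_image_cube {a : Pt P.d} {M ρ k : ℕ} (hρ : 1 ≤ ρ) (hinj : Set.InjOn (cover P) (tcube P.L a M ρ k))
    {A : PBond P 0 → MatA N} {A' : B7Prop1Explicit.Site P.d → Fin P.d → MatA N} {η : ℝ} (hη : 0 < η) {R : ℕ → ℝ}
    (hAid : ∀ x, x ∈ cubeZ P.L a M ρ k 0 → ∀ μ, A ⟨cover P (x + fun _ => (ctrShift P.L k : ℤ)), μ⟩ = A' x μ)
    (hlev : ∀ j, j ≤ k → ∀ (x : Pt P.d) (μ ν : Fin P.d), x ∈ cubeZ P.L a M ρ k j → x + e μ ∈ cubeZ P.L a M ρ k j →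
      ‖A' (x + e μ) ν - A' x ν‖ ≤ η * R j)
    {j : ℕ} (hj : j ≤ k) :
    ∀ q ∈ (Sect2.regionOfSet P (cover P '' cube P.L a M ρ k j)).dpairs, ‖grad η q.2.1 (fun y => A ⟨y, q.2.2⟩) q.1‖ ≤ R j := by
  intro q hq
  rw [Sect2.mem_regionOfSet_dpairs, ← image_coverShift_cubeZ a M ρ hj] at hq
  obtain ⟨⟨x, hx, hxs⟩, hq2, -, -⟩ := hq
  have hxs' : cover P (x + fun _ => (ctrShift P.L k : ℤ)) = q.1 := hxs
  have h' : (cover P (x + fun _ => (ctrShift P.L k : ℤ))).shift q.2.1 ∈ (fun x => cover P (x + fun _ => (ctrShift P.L k : ℤ))) '' cubeZ P.L a M ρ k j := by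
    rw [hxs']; exact hq2
  have hxμ : x + e q.2.1 ∈ cubeZ P.L a M ρ k j := add_e_mem_cubeZ_of_coverShift_mem_image hρ hj hinj hx h'
  have h0 : cubeZ P.L a M ρ k j ⊆ cubeZ P.L a M ρ k 0 := B8Eq131CubesRec.cube_anti P.hL.1 (Nat.zero_le j) hj
  rw [grad, ← hxs', ← cover_shift_add_e, hAid x (h0 hx), hAid (x + e q.2.1) (h0 hxμ), norm_smul, norm_inv, Complex.norm_real, Real.norm_eq_abs,
    abs_of_pos hη]
  calc η⁻¹ * ‖A' (x + e q.2.1) q.2.2 - A' x q.2.2‖ ≤ η⁻¹ * (η * R j) :=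
        mul_le_mul_of_nonneg_left (hlev j hj x q.2.1 q.2.2 hx hxμ) (inv_nonneg.2 hη.le)
    _ = R j := by field_simp

/-! ## §4  The crown-fed door WITH (T2b) -/

/-- ★★★ **THE R7 DOOR AT THE PRINT DATUM, FED FROM THE RUN's BOUNDS, WITH (T2b)** — g10's `exists_datumGauge152_153_member_of_crownAt` VERBATIM plus the torus-side row
«∀ j′ ≤ k, ∀ q ∈ regionOfSet(π″□_{j′}).dpairs, ‖grad η_k q.2.1 (A ⟨·, q.2.2⟩) q.1‖ ≤ 2·(Cr·L³·ε_{k−1})·((L^{j′}η_k)²)⁻¹» = [15] (152) member 2 at EVERY level for the SAME `A`.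
[cite: Balaban1985Variational, (144)–(153) pp.300–301, (152) p.301; Balaban1985RegularSpaces, Prop. 6 (1.135)–(1.138) p.99, (1.7)–(1.9) p.77, (1.29) p.81; Balaban1984PropagatorsII, (2.10)–(2.12) p.225; Balaban1988Convergent, (1.4) p.246; Balaban1987RG1, (0.1) p.251, (0.3)–(0.4) pp.252–253] -/
theorem exists_datumGauge152_153_member_of_crownAt_grad (hd : 2 ≤ P.d) {k : ℕ} (hk₁ : 1 ≤ k) (hck : k ≤ P.m + P.K) {Mc ρ : ℕ} (hρ : P.L ≤ ρ) (idx : Pt P.d)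
    {Ω : ℕ → Set (Site P 0)} {Ω₀ : Set (Site P 0)} {kT : ℕ} {ε : ℕ → ℝ} (U : GaugeField P 0 (SU N))
    (hP : ∀ m, m ≤ kT → PlaqSmallOn (Sect2.omegaPlaqsTop Ω Ω₀ m) (ε m * P.eta m ^ 2) U)
    (hD : ∀ m, m ≤ kT → Sect2.CoDivSmallOn (Sect2.omegaBondsTop Ω Ω₀ m) (ε m * P.eta m ^ 3) U)
    (hkT : k ≤ kT + 1) (hε : 0 < ε (k - 1))
    (hcollar : cover P '' tcube P.L (cornerP P Mc ρ idx) (sideP P Mc ρ) ρ k ⊆ (if k - 1 = 0 then Ω₀ else Ω (k - 1)))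
    {Cr : ℝ} (hCr : 0 ≤ Cr)
    (hP6 : letI : CStarAlgebra (MatA N) := {};
      InAk P.L k (P.eta k) ((P.L : ℝ) ^ 3 * ε (k - 1)) (fun _ => tcubeZ P.L (cornerP P Mc ρ idx) (sideP P Mc ρ) ρ k)
          (fun x μ => ιSU N (U ⟨cover P (x + fun _ => (ctrShift P.L k : ℤ)), μ⟩)) →
      ∃ u : B7Prop1Explicit.Site P.d → (MatA N)ˣ, (∀ x, u x ∈ specialUnitaryUnits (Fin N)) ∧ (∀ x, x ∉ (propCubePZ P k hk₁ Mc ρ hρ idx).sq 0 → u x = 1) ∧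
        Restr129Z P.L k (propCubePZ P k hk₁ Mc ρ hρ idx).lamS (1 : B7Prop1Explicit.Site P.d → Fin P.d → (MatA N)ˣ) u ∧
        IsLandau138WZ P.L k (P.eta k) ((propCubePZ P k hk₁ Mc ρ hρ idx).sq 0) (propCubePZ P k hk₁ Mc ρ hρ idx).lamS (1 : B7Prop1Explicit.Site P.d → Fin P.d → (MatA N)ˣ)
          ((propCubePZ P k hk₁ Mc ρ hρ idx).fixed (fun x μ => ιSU N (U ⟨cover P (x + fun _ => (ctrShift P.L k : ℤ)), μ⟩)) u) ∧
        (∀ j, j ≤ k → ∀ b ∈ {b : B7Prop1Explicit.Site P.d × Fin P.d | SideTouches ((propCubePZ P k hk₁ Mc ρ hρ idx).sq j) b.1 b.2},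
          (propCubePZ P k hk₁ Mc ρ hρ idx).fixed (fun x μ => ιSU N (U ⟨cover P (x + fun _ => (ctrShift P.L k : ℤ)), μ⟩)) u b.1 b.2 =
              cfgExp (P.eta k) (logCfg (P.eta k) ((propCubePZ P k hk₁ Mc ρ hρ idx).fixed (fun x μ => ιSU N (U ⟨cover P (x + fun _ => (ctrShift P.L k : ℤ)), μ⟩)) u)) b.1 b.2 ∧
            IsSelfAdjoint (logCfg (P.eta k) ((propCubePZ P k hk₁ Mc ρ hρ idx).fixed (fun x μ => ιSU N (U ⟨cover P (x + fun _ => (ctrShift P.L k : ℤ)), μ⟩)) u) b.1 b.2) ∧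
            ‖logCfg (P.eta k) ((propCubePZ P k hk₁ Mc ρ hρ idx).fixed (fun x μ => ιSU N (U ⟨cover P (x + fun _ => (ctrShift P.L k : ℤ)), μ⟩)) u) b.1 b.2‖ ≤
              (Cr * ((P.L : ℝ) ^ 3 * ε (k - 1))) * ((P.L : ℝ) ^ j * P.eta k)⁻¹) ∧
        (∀ x, (((propCubePZ P k hk₁ Mc ρ hρ idx).vfix (fun x μ => ιSU N (U ⟨cover P (x + fun _ => (ctrShift P.L k : ℤ)), μ⟩)))⁻¹ * u) x ∈ specialUnitaryUnits (Fin N)) ∧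
        AgreeOn (B8Ineq130Rec.tlo P.L (tLo (cornerP P Mc ρ idx) ρ) k) (B8Ineq130Rec.thi P.L (tHi (cornerP P Mc ρ idx) (sideP P Mc ρ) ρ) k)
          (gaugeAct (((propCubePZ P k hk₁ Mc ρ hρ idx).vfix (fun x μ => ιSU N (U ⟨cover P (x + fun _ => (ctrShift P.L k : ℤ)), μ⟩)))⁻¹ * u)⁻¹
            (fun x μ => ιSU N (U ⟨cover P (x + fun _ => (ctrShift P.L k : ℤ)), μ⟩)))
          ((propCubePZ P k hk₁ Mc ρ hρ idx).fixed (fun x μ => ιSU N (U ⟨cover P (x + fun _ => (ctrShift P.L k : ℤ)), μ⟩)) u) ∧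
        msup P.L k (P.eta k) (-(2 : ℝ)) (fun j (q : Fin P.d × Fin P.d × B7Prop1Explicit.Site P.d) => SideTouches ((propCubePZ P k hk₁ Mc ρ hρ idx).sq j) q.2.2 q.2.1)
            (fun q => covDerivFwd (P.eta k) (1 : B7Prop1Explicit.Site P.d → Fin P.d → (MatA N)ˣ) q.1
              (fun z => (propCubePZ P k hk₁ Mc ρ hρ idx).expo (P.eta k) (fun x μ => ιSU N (U ⟨cover P (x + fun _ => (ctrShift P.L k : ℤ)), μ⟩)) u z q.2.1) q.2.2) ≤ Cr * ((P.L : ℝ) ^ 3 * ε (k - 1)) ∧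
        bondNorm P.L k (P.eta k) (-(3 : ℝ)) (propCubePZ P k hk₁ Mc ρ hρ idx).sq
            (fun x μ => pdiv (P.eta k) (1 : B7Prop1Explicit.Site P.d → Fin P.d → (MatA N)ˣ)
              (plaqCovDeriv (P.eta k) (1 : B7Prop1Explicit.Site P.d → Fin P.d → (MatA N)ˣ)
                ((propCubePZ P k hk₁ Mc ρ hρ idx).expo (P.eta k) (fun x μ => ιSU N (U ⟨cover P (x + fun _ => (ctrShift P.L k : ℤ)), μ⟩)) u)) μ x) ≤ Cr * ((P.L : ℝ) ^ 3 * ε (k - 1)) ∧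
        bondNorm P.L k (P.eta k) (-(3 : ℝ)) (propCubePZ P k hk₁ Mc ρ hρ idx).sq
            (fun x μ => covLap (P.eta k) (1 : B7Prop1Explicit.Site P.d → Fin P.d → (MatA N)ˣ)
              (fun z => (propCubePZ P k hk₁ Mc ρ hρ idx).expo (P.eta k) (fun x μ => ιSU N (U ⟨cover P (x + fun _ => (ctrShift P.L k : ℤ)), μ⟩)) u z μ) x) ≤ Cr * ((P.L : ℝ) ^ 3 * ε (k - 1)) ∧
        (∀ (x : B7Prop1Explicit.Site P.d) (μ : Fin P.d), bLoZ P.L (cornerP P Mc ρ idx) 0 0 ≤ x → x + e μ ≤ bHiZ P.L (cornerP P Mc ρ idx) (sideP P Mc ρ) 0 0 →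
          (propCubePZ P k hk₁ Mc ρ hρ idx).inTop x → (propCubePZ P k hk₁ Mc ρ hρ idx).inTop (x + e μ) →
          logCovIterZ P.L (1 : B7Prop1Explicit.Site P.d → Fin P.d → (MatA N)ˣ)
              (iEta (P.eta k) ((propCubePZ P k hk₁ Mc ρ hρ idx).expo (P.eta k) (fun x μ => ιSU N (U ⟨cover P (x + fun _ => (ctrShift P.L k : ℤ)), μ⟩)) u)) k x μ =
            mlog ((avgIterZ P.L ((propCubePZ P k hk₁ Mc ρ hρ idx).axial (fun x μ => ιSU N (U ⟨cover P (x + fun _ => (ctrShift P.L k : ℤ)), μ⟩))) k x μ : (MatA N)ˣ) :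
              MatA N)))
    (hinj : Set.InjOn (cover P) (tcube P.L (cornerP P Mc ρ idx) (sideP P Mc ρ) ρ k))
    (h4 : 4 * ((N : ℝ) * (Cr * ((P.L : ℝ) ^ 3 * ε (k - 1)))) < 2 * Real.pi) :
    letI : CStarAlgebra (MatA N) := {}
    ∃ u : GaugeTransf P 0 (SU N), ∃ A : PBond P 0 → MatA N, ∃ um : B7Prop1Explicit.Site P.d → (MatA N)ˣ,
      (∀ b ∈ (Sect2.regionOfSet P (cover P '' cube P.L (cornerP P Mc ρ idx) (sideP P Mc ρ) ρ k 0)).bonds,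
          gaugeU (fun x => ιSU N (u x)) (fun b' => ιSU N (U b')) b = expI (P.eta k) (A b)) ∧
      (∀ j, j ≤ k → ∀ b ∈ (Sect2.regionOfSet P (cover P '' cube P.L (cornerP P Mc ρ idx) (sideP P Mc ρ) ρ k j)).bonds,
          ‖A b‖ ≤ 2 * ((Cr * ((P.L : ℝ) ^ 3 * ε (k - 1))) * ((P.L : ℝ) ^ j * P.eta k)⁻¹)) ∧
      (∀ b ∈ (Sect2.regionOfSet P (cover P '' box P.L (cornerP P Mc ρ idx) (sideP P Mc ρ) k)).bonds, ‖A b‖ ≤ 2 * ((Cr * ((P.L : ℝ) ^ 3 * ε (k - 1))) * P.L)) ∧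
      (∀ q ∈ (Sect2.regionOfSet P (cover P '' box P.L (cornerP P Mc ρ idx) (sideP P Mc ρ) k)).dpairs,
          ‖grad (P.eta k) q.2.1 (fun y => A ⟨y, q.2.2⟩) q.1‖ ≤ 2 * ((Cr * ((P.L : ℝ) ^ 3 * ε (k - 1))) * (P.L : ℝ) ^ 2)) ∧
      (∀ b ∈ Sect2.bondsDeep (cover P '' box P.L (cornerP P Mc ρ idx) (sideP P Mc ρ) k), ‖Sect2.codiffCurlA (P.eta k) A b.src b.dir‖ ≤ 2 * ((Cr * ((P.L : ℝ) ^ 3 * ε (k - 1))) * (P.L : ℝ) ^ 3)) ∧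
      (∀ b ∈ Sect2.bondsDeep (cover P '' box P.L (cornerP P Mc ρ idx) (sideP P Mc ρ) k),
          ‖∑ ν : Fin P.d, ((P.eta k : ℝ) : ℂ)⁻¹ •
              (grad (P.eta k) ν (fun y => A ⟨y, b.dir⟩) (b.src.unshift ν) - grad (P.eta k) ν (fun y => A ⟨y, b.dir⟩) b.src)‖ ≤ 2 * ((Cr * ((P.L : ℝ) ^ 3 * ε (k - 1))) * (P.L : ℝ) ^ 3)) ∧
      (∀ (D₂ : Domains P) (φ : MatA N →L[ℂ] ℂ),
        RE (domainsMeet (cubeDomains P (cornerP P Mc ρ idx) (sideP P Mc ρ) ρ k hck) D₂) (P.eta k)⁻¹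
            (dsE (P.eta k)⁻¹ (WithLp.toLp 2 fun b => (φ (A b)).re : BondSpace P)) = 0 ∧
          RE (domainsMeet (cubeDomains P (cornerP P Mc ρ idx) (sideP P Mc ρ) ρ k hck) D₂) (P.eta k)⁻¹
            (dsE (P.eta k)⁻¹ (WithLp.toLp 2 fun b => (φ (A b)).im : BondSpace P)) = 0) ∧
      (∀ x, x ∈ tcubeZ P.L (cornerP P Mc ρ idx) (sideP P Mc ρ) ρ k → ∀ μ,
          A ⟨cover P (x + fun _ => (ctrShift P.L k : ℤ)), μ⟩ =
            logCfg (P.eta k) ((propCubePZ P k hk₁ Mc ρ hρ idx).fixed (fun x μ => ιSU N (U ⟨cover P (x + fun _ => (ctrShift P.L k : ℤ)), μ⟩)) um) x μ) ∧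
      (∀ x, x ∈ (propCubePZ P k hk₁ Mc ρ hρ idx).sq 0 →
          ιSU N (u (cover P (x + fun _ => (ctrShift P.L k : ℤ)))) =
            (um x)⁻¹ * (propCubePZ P k hk₁ Mc ρ hρ idx).vfix (fun x μ => ιSU N (U ⟨cover P (x + fun _ => (ctrShift P.L k : ℤ)), μ⟩)) x) ∧
      (∀ x, um x ∈ specialUnitaryUnits (Fin N)) ∧ (∀ x, x ∉ (propCubePZ P k hk₁ Mc ρ hρ idx).sq 0 → um x = 1) ∧
      Restr129Z P.L k (propCubePZ P k hk₁ Mc ρ hρ idx).lamS (1 : B7Prop1Explicit.Site P.d → Fin P.d → (MatA N)ˣ) um ∧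
      (∀ (x : B7Prop1Explicit.Site P.d) (μ : Fin P.d), bLoZ P.L (cornerP P Mc ρ idx) 0 0 ≤ x → x + e μ ≤ bHiZ P.L (cornerP P Mc ρ idx) (sideP P Mc ρ) 0 0 →
        (propCubePZ P k hk₁ Mc ρ hρ idx).inTop x → (propCubePZ P k hk₁ Mc ρ hρ idx).inTop (x + e μ) →
        logCovIterZ P.L (1 : B7Prop1Explicit.Site P.d → Fin P.d → (MatA N)ˣ)
            (iEta (P.eta k) ((propCubePZ P k hk₁ Mc ρ hρ idx).expo (P.eta k) (fun x μ => ιSU N (U ⟨cover P (x + fun _ => (ctrShift P.L k : ℤ)), μ⟩)) um)) k x μ =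
          mlog ((avgIterZ P.L ((propCubePZ P k hk₁ Mc ρ hρ idx).axial (fun x μ => ιSU N (U ⟨cover P (x + fun _ => (ctrShift P.L k : ℤ)), μ⟩))) k x μ : (MatA N)ˣ) :
            MatA N)) ∧
      -- ★ NEW: (T2b) = [15] (152) member 2 AT EVERY LEVEL, in the head's torus currency
      (∀ j, j ≤ k → ∀ q ∈ (Sect2.regionOfSet P (cover P '' cube P.L (cornerP P Mc ρ idx) (sideP P Mc ρ) ρ k j)).dpairs,
          ‖grad (P.eta k) q.2.1 (fun y => A ⟨y, q.2.2⟩) q.1‖ ≤ 2 * ((Cr * ((P.L : ℝ) ^ 3 * ε (k - 1))) * (((P.L : ℝ) ^ j * P.eta k) ^ 2)⁻¹)) := by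
  letI : CStarAlgebra (MatA N) := {}
  have hηpos : 0 < P.eta k := B3GkZeroTorusRescaled.eta_pos P k
  set α : ℝ := (P.L : ℝ) ^ 3 * ε (k - 1) with hα
  have hαpos : 0 < α := mul_pos (pow_pos (by exact_mod_cast P.L_pos) 3) hε
  have hInAk : InAk P.L k (P.eta k) α (fun _ => tcubeZ P.L (cornerP P Mc ρ idx) (sideP P Mc ρ) ρ k)
      (fun x μ => ιSU N (U ⟨cover P (x + fun _ => (ctrShift P.L k : ℤ)), μ⟩)) :=
    inAk_coverLiftShift_tcubeZ_of_top N U hP hD (cornerP P Mc ρ idx) (sideP P Mc ρ) ρ k hηpos (fun _ => k - 1) (fun j _ => by omega) (fun j _ => hcollar)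
      (fun j hj => (tol_of_level_pred P hk₁ hε.le hj).1) (fun j hj => (tol_of_level_pred P hk₁ hε.le hj).2)
  have hG := hP6 hInAk
  have hr : 0 ≤ Cr * α := mul_nonneg hCr hαpos.le
  have hρ1 : 1 ≤ ρ := le_trans (le_trans (by norm_num) P.hL.2) hρ
  obtain ⟨u, A, um, h1, hlev, h2, h3, h4c, h4', h5, hA7, hsid, hsu, hoff, h129, h137, hgradAll, -⟩ :=
    exists_datumGauge152_153_member_of_recBody_grad hd hk₁ hck hρ idx U hr hG hinj h4
  refine ⟨u, A, um, h1, fun j hj => ?_, h2, h3, h4c, h4', h5, hA7, hsid, hsu, hoff, h129, h137, fun j hj => ?_⟩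
  swap
  · -- (T2b): pull each derivative stencil of `regionOfSet (π '' □_j)` back to `□_jᶻ = (propCubePZ …).sq j` and read the ℤᵈ letter
    refine norm_grad_le_of_mem_regionOfSet_cover_image_cube (N := N) hρ1 hinj hηpos
      (R := fun j => 2 * ((Cr * α) * (((P.L : ℝ) ^ j * P.eta k) ^ 2)⁻¹))
      (fun x hx μ => hA7 x (CubeB8DZ.sq_zero_subset_tcube P.hL.1 P.hL.2 (propCubePZ P k hk₁ Mc ρ hρ idx)
        (by rw [propCubePZ_sq_eq_cubeZ (P := P) k hk₁ Mc ρ hρ idx (Nat.zero_le k)]; exact hx)) μ)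
      (fun j' hj' x μ ν hx hx' => ?_) hj
    rw [← propCubePZ_sq_eq_cubeZ (P := P) k hk₁ Mc ρ hρ idx hj'] at hx hx'
    have h := hgradAll j' hj' x μ ν hx hx'
    calc _ ≤ 2 * (P.eta k * (Cr * α) * (((P.L : ℝ) ^ j' * P.eta k) ^ 2)⁻¹) := h
      _ = P.eta k * (2 * ((Cr * α) * (((P.L : ℝ) ^ j' * P.eta k) ^ 2)⁻¹)) := by ring
  -- row 2 in the torus currency: pull each bond of `regionOfSet (π '' □_j)` back to a bond of `□_jᶻ = (propCubePZ …).sq j`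
  refine norm_le_of_mem_regionOfSet_cover_image_cube (N := N) hρ1 hinj (R := fun j => 2 * ((Cr * α) * ((P.L : ℝ) ^ j * P.eta k)⁻¹))
    (fun j' hj' x μ hx hx' => ?_) hj
  rw [← propCubePZ_sq_eq_cubeZ (P := P) k hk₁ Mc ρ hρ idx hj'] at hx hx'
  exact hlev j' hj' x μ hx hx'

end Literature.MathematicalPhysics.QuantumFieldTheory.Balaban1983to89.Node00

end

/-! ## Axiom audit (gate whitelist: `propext`, `Classical.choice`, `Quot.sound`) -/
#print axioms Literature.MathematicalPhysics.QuantumFieldTheory.Balaban1983to89.Node00.exists_datumGauge152_153_member_of_crownAt_grad
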